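import Mathlib
import HarnessLib
import Summits.ResolutionOfSingularities.ResolutionOfSingularities.Theorems.HomologicalConductorSurfaceTerminationAnnCoker

/-!
# Kill test `SurfaceTermination` (stmt-ResolutionOfSingularities-16488), THEOREM 23-S∞ step (S3), second half —
# over a GCD domain the colon `((δ) : J)` of a principal ideal by a finitely generated ideal is PRINCIPAL, so
# `Ann(coker A) = (det A : I_{n−1}(A))` is principal, generated by `det A / gcd(det A, gcd of the (n−1)-minors)`

Route `ResolutionOfSingularities/HomologicalConductor`, crux chain W4.4 (lead g24; KERNEL-g24 §1.3 (iii-c) «UFD COLON», on top of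
p730921 `…SurfaceTerminationAnnCoker`).  `[OURS]` — AI-formalised, weaker than expert review; NOT a statement of the manuscript
under review (Hironaka 2017); pure GCD-domain algebra, no resolution / cohomology-annihilator infrastructure.

* `forall_dvd_mul_iff_dvd_mul_gcd` — `δ ∣ s·f j` for all `j ∈ S` iff `δ ∣ s · gcd_S f`;
* `dvd_mul_iff_of_extract` — with `δ = d·δ′`, `g = d·g′`, `gcd(δ′, g′)` a unit, `d ≠ 0`: `δ ∣ s·g ↔ δ′ ∣ s`;
* `exists_colon_span_singleton_eq` / `isPrincipal_colon_span_singleton` — `((δ) : f(S)) = (δ′)`, `δ = gcd(δ, gcd_S f)·δ′`,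
  for `δ ≠ 0` and `S` finite: **principal**;
* `exists_annihilator_coker_eq_span` / `annihilator_coker_isPrincipal` — for a square matrix `A` over a GCD domain with
  `det A ≠ 0`, `Ann_R(Rⁿ ⧸ A·Rⁿ) = (a)` with `det A = gcd(det A, gcd{adjugate entries}) · a`.
Use in the cell: at a point `x` of the (regular, two-dimensional, hence factorial) resolution `X̃`, with `Φ_x : ℳ′_x → ℳ^∨_x` the
comparison matrix of the full sheaves of a reflexive module, `𝒜_{M,x} = Ann(coker Φ_x) = (det Φ_x / gcd) ` is principal:
`𝒜_M = 𝒪_X̃(−A_M)` is INVERTIBLE with `A_M = div(det Φ) − (divisorial part of I_{r−1}(Φ)) = D_M − B_M` (THEOREM 23-S∞ (S3)).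
-/

-- single-problem summit: the doubled namespace component is forced
set_option linter.dupNamespace false

namespace Summit.ResolutionOfSingularities.ResolutionOfSingularities.Theorems.SurfaceTermination.ColonPrincipal

open Matrix
open Summit.ResolutionOfSingularities.ResolutionOfSingularities.Theorems.SurfaceTermination.AnnCoker

variable {R : Type*} [CommRing R] [IsDomain R] [NormalizedGCDMonoid R] {ι : Type*}

omit [IsDomain R] in
/-- `δ` divides `s · f j` for every `j` in the finite set `S` iff `δ` divides `s · gcd_{j ∈ S} f j`. [folklore] -/
theorem forall_dvd_mul_iff_dvd_mul_gcd (δ s : R) (S : Finset ι) (f : ι → R) :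
    (∀ j ∈ S, δ ∣ s * f j) ↔ δ ∣ s * S.gcd f := by
  constructor
  · intro h
    have h1 : δ ∣ S.gcd (fun j => s * f j) := Finset.dvd_gcd fun j hj => h j hj
    exact (Finset.gcd_mul_left' S f s).dvd_iff_dvd_right.mp h1
  · intro h j hj
    exact h.trans (mul_dvd_mul_left s (Finset.gcd_dvd (f := f) hj))

omit [NormalizedGCDMonoid R] in
/-- Coprime reduction: if `δ = d·δ′`, `g = d·g′` with `d ≠ 0` and `gcd(δ′, g′)` a unit (for SOME `GCDMonoid` structure), then
`δ ∣ s·g ↔ δ′ ∣ s`. [folklore] -/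
theorem dvd_mul_iff_of_extract [GCDMonoid R] {δ g d δ' g' : R} (hd : d ≠ 0) (hδ : δ = d * δ') (hg : g = d * g')
    (hu : IsUnit (gcd δ' g')) (s : R) : δ ∣ s * g ↔ δ' ∣ s := by
  rw [hδ, hg, mul_left_comm, mul_dvd_mul_iff_left hd]
  constructor
  · intro h
    exact hu.dvd_mul_right.mp (dvd_mul_gcd_of_dvd_mul h)
  · intro h
    exact h.mul_right _

/-- **`((δ) : {f j}_{j ∈ S})` is principal over a GCD domain**: for `δ ≠ 0` and a finite family, writing
`δ = gcd(δ, gcd_S f)·δ′`, the colon ideal `{s : s·f(S) ⊆ (δ)}` equals `(δ′)`. [folklore; the «UFD colon» of KERNEL-g24 §1.3] -/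
theorem exists_colon_span_singleton_eq (δ : R) (hδ : δ ≠ 0) (S : Finset ι) (f : ι → R) :
    ∃ δ' : R, δ = gcd δ (S.gcd f) * δ' ∧ (Ideal.span {δ}).colon (f '' (S : Set ι)) = Ideal.span {δ'} := by
  obtain ⟨δ', g', hδ', hg', hu⟩ := extract_gcd δ (S.gcd f)
  have hd : gcd δ (S.gcd f) ≠ 0 := fun h => hδ ((gcd_eq_zero_iff _ _).mp h).1
  refine ⟨δ', hδ', ?_⟩
  ext s
  rw [Submodule.mem_colon, Ideal.mem_span_singleton]
  simp only [Set.forall_mem_image, Finset.mem_coe, smul_eq_mul, Ideal.mem_span_singleton]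
  rw [forall_dvd_mul_iff_dvd_mul_gcd, dvd_mul_iff_of_extract hd hδ' hg' hu]

/-- Corollary: `((δ) : {f j}_{j ∈ S})` is a principal ideal (`δ ≠ 0`, `S` finite, `R` a GCD domain). [folklore] -/
theorem isPrincipal_colon_span_singleton (δ : R) (hδ : δ ≠ 0) (S : Finset ι) (f : ι → R) :
    ((Ideal.span {δ}).colon (f '' (S : Set ι))).IsPrincipal := by
  obtain ⟨δ', -, h⟩ := exists_colon_span_singleton_eq δ hδ S f
  rw [h]
  exact ⟨⟨δ', rfl⟩⟩

/-- **The annihilator of the cokernel of a square matrix over a GCD domain is principal, with an explicit generator**: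
if `det A ≠ 0` then `Ann_R(Rⁿ ⧸ A·Rⁿ) = (a)` where `det A = gcd(det A, gcd_{i,j} (adj A)ᵢⱼ) · a` — «`A_M = D_M − B_M`».
[this work; THEOREM 23-S∞ (S3)] -/
theorem exists_annihilator_coker_eq_span {n : Type*} [Fintype n] [DecidableEq n] (A : Matrix n n R)
    (hdet : A.det ≠ 0) :
    ∃ a : R, A.det = gcd A.det ((Finset.univ : Finset (n × n)).gcd fun p => A.adjugate p.1 p.2) * a ∧
      Module.annihilator R ((n → R) ⧸ LinearMap.range A.mulVecLin) = Ideal.span {a} := by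
  obtain ⟨a, ha, h⟩ := exists_colon_span_singleton_eq A.det hdet (Finset.univ : Finset (n × n))
    (fun p : n × n => A.adjugate p.1 p.2)
  refine ⟨a, ha, ?_⟩
  rw [annihilator_coker_eq_colon A (mem_nonZeroDivisors_of_ne_zero hdet), ← h, Finset.coe_univ, Set.image_univ]

/-- Corollary: `Ann_R(Rⁿ ⧸ A·Rⁿ)` is a principal ideal for every square matrix `A` with `det A ≠ 0` over a GCD domain
(e.g. a regular local ring of dimension two) — the invertibility of `𝒜_M = Ann(ℳ^∨/ℳ′)` in THEOREM 23-S∞ (S3). [this work] -/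
theorem annihilator_coker_isPrincipal {n : Type*} [Fintype n] [DecidableEq n] (A : Matrix n n R)
    (hdet : A.det ≠ 0) :
    (Module.annihilator R ((n → R) ⧸ LinearMap.range A.mulVecLin)).IsPrincipal := by
  obtain ⟨a, -, h⟩ := exists_annihilator_coker_eq_span A hdet
  rw [h]
  exact ⟨⟨a, rfl⟩⟩

end Summit.ResolutionOfSingularities.ResolutionOfSingularities.Theorems.SurfaceTermination.ColonPrincipal
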